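import Mathlib
import Summits.CriticalPhenomena.Ising3DConformalLimit.Theses.HyperoctahedralRP
import Literature.MathematicalPhysics.QuantumFieldTheory.LatticeMirrorNormals
import Literature.MathematicalPhysics.QuantumFieldTheory.MirrorRPKernel

/-!
# Crux `HyperoctahedralRP.HRP2Rigidity` (stmt-CriticalPhenomena-1979) — negative-side support, I

Standing crux disprover (cdisprove), THEOREM-ONLY file (no definitions, no named facts):

* `hrp2Rigidity_false_without_RP` — LOAD-BEARING: the crux with its reflection-positivity conjunct dropped
  (the nine mirror invariances kept) is false; witness `K x = (Σ xᵢ⁴)/(Σ xᵢ²)³` at `Δ = 1`, which is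
  continuous and positive off `0`, homogeneous of degree `-2`, `O_h`-invariant, and has
  `K e₀ = 1 ≠ 11/27 = K (θ_{(1,1,1)} e₀)`. Any proof of the crux must use reflection positivity.
* `even_of_coordinate_mirrors` — the three coordinate mirrors compose to `x ↦ -x`.
* `rp_two_point`, `footpoint_bound` — the `m = 2` instance of the RP conjunct is Cauchy–Schwarz; with
  homogeneity, `K z ≤ ⟪z,n⟫^(-2Δ) K n` for a unit normal `n` (all that two-point RP gives).
Companion file `Negative/Descent.lean`: Schur product of RP kernels, Δ-monotonicity (Schur descent), and
the `a = 1` leaf monotonicity lemmas. Findings F1–F12: `Cruxes/HRP2Rigidity/Disproof.lean`.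
-/

noncomputable section

open scoped BigOperators InnerProductSpace Matrix

namespace Summit.CriticalPhenomena.Ising3DConformalLimit.Theorems.HRP2Rigidity.Negative

open Literature.MathematicalPhysics.QuantumFieldTheory

/-! ## The quartic witness `(Σ xᵢ⁴)/(Σ xᵢ²)³` -/

/-- `Σ xᵢ² > 0` off the origin. -/
theorem sum_sq_pos {x : (EuclideanSpace ℝ (Fin 3))} (hx : x ≠ 0) : 0 < ∑ i, x i ^ 2 := by
  have : ∃ i, x i ≠ 0 := by
    by_contra h
    push Not at h
    exact hx (PiLp.ext fun i => by simpa using h i)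
  obtain ⟨i, hi⟩ := this
  exact Finset.sum_pos' (fun j _ => by positivity) ⟨i, Finset.mem_univ _, by positivity⟩

/-- `Σ xᵢ⁴ > 0` off the origin. -/
theorem sum_fourth_pos {x : (EuclideanSpace ℝ (Fin 3))} (hx : x ≠ 0) : 0 < ∑ i, x i ^ 4 := by
  have : ∃ i, x i ≠ 0 := by
    by_contra h
    push Not at h
    exact hx (PiLp.ext fun i => by simpa using h i)
  obtain ⟨i, hi⟩ := this
  exact Finset.sum_pos' (fun j _ => by positivity) ⟨i, Finset.mem_univ _, by positivity⟩

/-- Coordinates are continuous. -/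
theorem continuous_coord (i : Fin 3) : Continuous fun x : (EuclideanSpace ℝ (Fin 3)) => x i :=
  (EuclideanSpace.proj i).continuous

/-- `(Σ xᵢ⁴)/(Σ xᵢ²)³` is continuous off the origin. -/
theorem quartic_continuousOn :
    ContinuousOn (fun x : (EuclideanSpace ℝ (Fin 3)) => (∑ i, x i ^ 4) / (∑ i, x i ^ 2) ^ 3) {0}ᶜ := by
  have h4 : Continuous fun x : (EuclideanSpace ℝ (Fin 3)) => ∑ i, x i ^ 4 :=
    continuous_finsetSum _ fun i _ => (continuous_coord i).pow 4
  have h2 : Continuous fun x : (EuclideanSpace ℝ (Fin 3)) => (∑ i, x i ^ 2) ^ 3 :=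
    (continuous_finsetSum _ fun i _ => (continuous_coord i).pow 2).pow 3
  refine ContinuousOn.div h4.continuousOn h2.continuousOn ?_
  intro x hx
  exact (pow_pos (sum_sq_pos hx) 3).ne'

/-- `(Σ xᵢ⁴)/(Σ xᵢ²)³` is homogeneous of degree `-2 = -(2·1)`. -/
theorem quartic_smul {c : ℝ} (hc : 0 < c) (x : (EuclideanSpace ℝ (Fin 3))) :
    (∑ i, (c • x) i ^ 4) / (∑ i, (c • x) i ^ 2) ^ 3 =
      c ^ (-(2 * (1:ℝ))) * ((∑ i, x i ^ 4) / (∑ i, x i ^ 2) ^ 3) := by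
  simp only [PiLp.smul_apply, smul_eq_mul, mul_pow]
  rw [← Finset.mul_sum, ← Finset.mul_sum]
  rw [show (-(2 * (1:ℝ))) = ((-2 : ℤ) : ℝ) by norm_num, Real.rpow_intCast]
  by_cases hs : ∑ i, x i ^ 2 = 0
  · simp [hs]
  · field_simp

/-- Coordinate-even, permutation-symmetric sums are invariant under the nine lattice mirrors. -/
theorem sum_comp_reflection_eq (F : ℝ → ℝ) (hF : ∀ a, F (-a) = F a) (n : (EuclideanSpace ℝ (Fin 3)))
    (hn : ∃ i j : Fin 3, i ≠ j ∧ (n = EuclideanSpace.single i 1 ∨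
      n = EuclideanSpace.single i 1 + EuclideanSpace.single j 1 ∨
      n = EuclideanSpace.single i 1 - EuclideanSpace.single j 1)) (x : (EuclideanSpace ℝ (Fin 3))) :
    ∑ l, F (((ℝ ∙ n)ᗮ.reflection x) l) = ∑ l, F (x l) := by
  obtain ⟨i, j, hij, rfl | rfl | rfl⟩ := hn
  · refine Finset.sum_congr rfl fun l _ => ?_
    rw [reflection_single_apply]
    split_ifs <;> simp [hF]
  · calc ∑ l, F (((ℝ ∙ (EuclideanSpace.single i (1:ℝ) + EuclideanSpace.single j 1))ᗮ.reflection x) l)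
        = ∑ l, F (x (Equiv.swap i j l)) := by
          refine Finset.sum_congr rfl fun l _ => ?_
          rw [reflection_single_add_single_apply hij]
          by_cases hli : l = i
          · subst hli; simp [hF]
          · by_cases hlj : l = j
            · subst hlj; simp [hli, hF]
            · simp [hli, hlj, Equiv.swap_apply_of_ne_of_ne hli hlj]
      _ = ∑ l, F (x l) := Equiv.sum_comp (Equiv.swap i j) (fun l => F (x l))
  · calc ∑ l, F (((ℝ ∙ (EuclideanSpace.single i (1:ℝ) - EuclideanSpace.single j 1))ᗮ.reflection x) l)
        = ∑ l, F (x (Equiv.swap i j l)) := by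
          refine Finset.sum_congr rfl fun l _ => ?_
          rw [reflection_single_sub_single_apply hij]
      _ = ∑ l, F (x l) := Equiv.sum_comp (Equiv.swap i j) (fun l => F (x l))

/-- The quartic witness is invariant under the nine lattice mirrors. -/
theorem quartic_reflection (n : (EuclideanSpace ℝ (Fin 3)))
    (hn : ∃ i j : Fin 3, i ≠ j ∧ (n = EuclideanSpace.single i 1 ∨
      n = EuclideanSpace.single i 1 + EuclideanSpace.single j 1 ∨
      n = EuclideanSpace.single i 1 - EuclideanSpace.single j 1)) (x : (EuclideanSpace ℝ (Fin 3))) :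
    (∑ i, ((ℝ ∙ n)ᗮ.reflection x) i ^ 4) / (∑ i, ((ℝ ∙ n)ᗮ.reflection x) i ^ 2) ^ 3 =
      (∑ i, x i ^ 4) / (∑ i, x i ^ 2) ^ 3 := by
  rw [sum_comp_reflection_eq (fun a => a ^ 4) (fun a => by ring) n hn x,
    sum_comp_reflection_eq (fun a => a ^ 2) (fun a => by ring) n hn x]

/-- Every coordinate of `(1,1,1)` is `1`. -/
theorem v111_apply (l : Fin 3) :
    (EuclideanSpace.single 0 1 + EuclideanSpace.single 1 1 + EuclideanSpace.single 2 1 : (EuclideanSpace ℝ (Fin 3))) l = 1 := by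
  fin_cases l <;> simp

/-- The reflection in the plane `⊥ (1,1,1)` sends `e₀` to `(1/3, -2/3, -2/3)`. -/
theorem reflection_v111_e0_apply (l : Fin 3) :
    ((ℝ ∙ (EuclideanSpace.single 0 1 + EuclideanSpace.single 1 1 + EuclideanSpace.single 2 1 : (EuclideanSpace ℝ (Fin 3))))ᗮ.reflection
      (EuclideanSpace.single (0 : Fin 3) (1 : ℝ))) l = (if l = 0 then 1 else 0) - 2 / 3 := by
  set v : (EuclideanSpace ℝ (Fin 3)) := EuclideanSpace.single 0 1 + EuclideanSpace.single 1 1 + EuclideanSpace.single 2 1 with hv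
  have hva : ∀ l, v l = 1 := v111_apply
  have hinner : ⟪EuclideanSpace.single (0 : Fin 3) (1 : ℝ), v⟫_ℝ = 1 := by
    rw [inner_single_one_left, hva]
  have hnorm : ‖v‖ ^ 2 = 3 := by
    rw [EuclideanSpace.norm_eq, Real.sq_sqrt (Finset.sum_nonneg fun _ _ => by positivity)]
    norm_num [hva, Fin.sum_univ_three]
  rw [mirrorReflection_apply, hinner, hnorm]
  norm_num [hva]

/-- The quartic witness takes the value `1` at `e₀`. -/
theorem quartic_e0 :
    (∑ i, (EuclideanSpace.single (0 : Fin 3) (1 : ℝ) : (EuclideanSpace ℝ (Fin 3))) i ^ 4) /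
      (∑ i, (EuclideanSpace.single (0 : Fin 3) (1 : ℝ) : (EuclideanSpace ℝ (Fin 3))) i ^ 2) ^ 3 = 1 := by
  simp

/-- The quartic witness takes the value `11/27` at `θ_{(1,1,1)} e₀ = (1/3, -2/3, -2/3)`. -/
theorem quartic_reflection_v111_e0 :
    (∑ i, (((ℝ ∙ (EuclideanSpace.single 0 1 + EuclideanSpace.single 1 1 +
        EuclideanSpace.single 2 1 : (EuclideanSpace ℝ (Fin 3))))ᗮ).reflection (EuclideanSpace.single (0 : Fin 3) (1 : ℝ))) i ^ 4) /
      (∑ i, (((ℝ ∙ (EuclideanSpace.single 0 1 + EuclideanSpace.single 1 1 +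
        EuclideanSpace.single 2 1 : (EuclideanSpace ℝ (Fin 3))))ᗮ).reflection (EuclideanSpace.single (0 : Fin 3) (1 : ℝ))) i ^ 2) ^ 3 =
      11 / 27 := by
  have h1 : ((ℝ ∙ (EuclideanSpace.single 0 1 + EuclideanSpace.single 1 1 +
      EuclideanSpace.single 2 1 : (EuclideanSpace ℝ (Fin 3))))ᗮ.reflection (EuclideanSpace.single (0 : Fin 3) (1 : ℝ))) 0 = 1 / 3 := by
    rw [reflection_v111_e0_apply, if_pos rfl]; norm_num
  have h2 : ((ℝ ∙ (EuclideanSpace.single 0 1 + EuclideanSpace.single 1 1 +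
      EuclideanSpace.single 2 1 : (EuclideanSpace ℝ (Fin 3))))ᗮ.reflection (EuclideanSpace.single (0 : Fin 3) (1 : ℝ))) 1 = -(2 / 3) := by
    rw [reflection_v111_e0_apply, if_neg (by decide)]; norm_num
  have h3 : ((ℝ ∙ (EuclideanSpace.single 0 1 + EuclideanSpace.single 1 1 +
      EuclideanSpace.single 2 1 : (EuclideanSpace ℝ (Fin 3))))ᗮ.reflection (EuclideanSpace.single (0 : Fin 3) (1 : ℝ))) 2 = -(2 / 3) := by
    rw [reflection_v111_e0_apply, if_neg (by decide)]; norm_num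
  simp only [Fin.sum_univ_three, h1, h2, h3]
  norm_num

/-- **LOAD-BEARING (RP).** The crux `HRP2Rigidity` with its reflection-positivity conjunct dropped is
FALSE: the quartic kernel `(Σ xᵢ⁴)/(Σ xᵢ²)³` at `Δ = 1` satisfies every remaining hypothesis and is not
`O(3)`-invariant. -/
theorem hrp2Rigidity_false_without_RP :
    ¬ (∀ (Δ : ℝ) (K : (EuclideanSpace ℝ (Fin 3)) → ℝ), 1/2 ≤ Δ → Δ ≤ 1 → ContinuousOn K {0}ᶜ →
      (∀ x, x ≠ 0 → 0 < K x) → (∀ c : ℝ, 0 < c → ∀ x, K (c • x) = c ^ (-(2 * Δ)) * K x) →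
      (∀ n : (EuclideanSpace ℝ (Fin 3)), (∃ i j : Fin 3, i ≠ j ∧ (n = EuclideanSpace.single i 1 ∨
        n = EuclideanSpace.single i 1 + EuclideanSpace.single j 1 ∨
        n = EuclideanSpace.single i 1 - EuclideanSpace.single j 1)) →
        (∀ x, K (((ℝ ∙ n)ᗮ).reflection x) = K x)) →
      ∀ (R : (EuclideanSpace ℝ (Fin 3)) ≃ₗᵢ[ℝ] (EuclideanSpace ℝ (Fin 3))) (x : (EuclideanSpace ℝ (Fin 3))), K (R x) = K x) := by
  intro h
  have key := h 1 (fun x : (EuclideanSpace ℝ (Fin 3)) => (∑ i, x i ^ 4) / (∑ i, x i ^ 2) ^ 3) (by norm_num) le_rfl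
    quartic_continuousOn (fun x hx => div_pos (sum_fourth_pos hx) (pow_pos (sum_sq_pos hx) 3))
    (fun c hc x => quartic_smul hc x) (fun n hn x => quartic_reflection n hn x)
    ((ℝ ∙ (EuclideanSpace.single 0 1 + EuclideanSpace.single 1 1 + EuclideanSpace.single 2 1 : (EuclideanSpace ℝ (Fin 3))))ᗮ.reflection)
    (EuclideanSpace.single (0 : Fin 3) (1 : ℝ))
  rw [quartic_reflection_v111_e0, quartic_e0] at key
  norm_num at key

/-! ## Evenness from the coordinate mirrors -/

/-- Composing the three coordinate mirrors gives `x ↦ -x`. -/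
theorem reflection_e0_e1_e2 (x : (EuclideanSpace ℝ (Fin 3))) :
    (ℝ ∙ EuclideanSpace.single (0 : Fin 3) (1 : ℝ))ᗮ.reflection
      ((ℝ ∙ EuclideanSpace.single (1 : Fin 3) (1 : ℝ))ᗮ.reflection
        ((ℝ ∙ EuclideanSpace.single (2 : Fin 3) (1 : ℝ))ᗮ.reflection x)) = -x := by
  ext l
  simp only [reflection_single_apply, PiLp.neg_apply]
  fin_cases l <;> simp

/-- TOOL: invariance under the nine (indeed the three coordinate) mirrors makes `K` even. -/
theorem even_of_coordinate_mirrors {K : (EuclideanSpace ℝ (Fin 3)) → ℝ}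
    (hinv : ∀ n : (EuclideanSpace ℝ (Fin 3)), (∃ i j : Fin 3, i ≠ j ∧ (n = EuclideanSpace.single i 1 ∨
      n = EuclideanSpace.single i 1 + EuclideanSpace.single j 1 ∨
      n = EuclideanSpace.single i 1 - EuclideanSpace.single j 1)) →
      ∀ x, K (((ℝ ∙ n)ᗮ).reflection x) = K x) (x : (EuclideanSpace ℝ (Fin 3))) :
    K (-x) = K x := by
  have h0 := hinv _ ⟨0, 1, by decide, Or.inl rfl⟩
  have h1 := hinv _ ⟨1, 0, by decide, Or.inl rfl⟩
  have h2 := hinv _ ⟨2, 0, by decide, Or.inl rfl⟩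
  rw [← reflection_e0_e1_e2 x, h0, h1, h2]

/-! ## Two-point RP and the foot-point bound -/

/-- `2 × 2` principal-minor inequality from a real quadratic form nonnegative on `Fin 2`. -/
theorem sq_le_mul_of_quadForm_nonneg {a b d : ℝ}
    (h : ∀ c : Fin 2 → ℝ, 0 ≤ ∑ i, ∑ j, c i * c j * (![![a, b], ![b, d]] i j)) :
    b ^ 2 ≤ a * d := by
  have ha : 0 ≤ a := by simpa [Fin.sum_univ_two] using h ![1, 0]
  have hd : 0 ≤ d := by simpa [Fin.sum_univ_two] using h ![0, 1]
  have h1 : 0 ≤ d * (a * d - b ^ 2) := by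
    have := h ![d, -b]; simp [Fin.sum_univ_two] at this; nlinarith [this]
  have h2 : 0 ≤ a * (a * d - b ^ 2) := by
    have := h ![-b, a]; simp [Fin.sum_univ_two] at this; nlinarith [this]
  have h3 : 0 ≤ a + d + 2 * b := by
    have := h ![1, 1]; simp [Fin.sum_univ_two] at this; nlinarith [this]
  have h4 : 0 ≤ a + d - 2 * b := by
    have := h ![1, -1]; simp [Fin.sum_univ_two] at this; nlinarith [this]
  by_cases hpos : 0 < a + d
  · nlinarith [h1, h2, hpos]
  · have had : a + d = 0 := le_antisymm (not_lt.1 hpos) (add_nonneg ha hd)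
    have hb : b = 0 := by nlinarith [h3, h4, had]
    subst hb; nlinarith [ha, hd]

/-- TOOL (two-point RP): the `m = 2` instance of the crux's RP conjunct, for a kernel symmetric on
the half-space, is the Cauchy–Schwarz inequality `K(p - θq)² ≤ K(p - θp) K(q - θq)`. -/
theorem rp_two_point {n : (EuclideanSpace ℝ (Fin 3))} {K : (EuclideanSpace ℝ (Fin 3)) → ℝ}
    (hRP : ∀ (m : ℕ) (p : Fin m → (EuclideanSpace ℝ (Fin 3))) (c : Fin m → ℝ), (∀ a, 0 < inner ℝ (p a) n) →
      0 ≤ ∑ a, ∑ b, c a * c b * K (p a - ((ℝ ∙ n)ᗮ).reflection (p b)))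
    (hsymm : ∀ p q : (EuclideanSpace ℝ (Fin 3)), K (p - (ℝ ∙ n)ᗮ.reflection q) = K (q - (ℝ ∙ n)ᗮ.reflection p))
    {p q : (EuclideanSpace ℝ (Fin 3))} (hp : 0 < ⟪p, n⟫_ℝ) (hq : 0 < ⟪q, n⟫_ℝ) :
    K (p - (ℝ ∙ n)ᗮ.reflection q) ^ 2 ≤
      K (p - (ℝ ∙ n)ᗮ.reflection p) * K (q - (ℝ ∙ n)ᗮ.reflection q) := by
  apply sq_le_mul_of_quadForm_nonneg
  intro c
  have h := hRP 2 ![p, q] c (fun a => by fin_cases a <;> simpa)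
  convert h using 1
  simp only [Fin.sum_univ_two, Matrix.cons_val_zero, Matrix.cons_val_one]
  rw [hsymm q p]

/-- TOOL (foot-point bound): for an even, `θ_n`-invariant, `θ_n`-RP kernel homogeneous of degree `-2Δ`
and a UNIT normal `n`, every value in the open half-space is bounded by the value at the foot point:
`K z ≤ ⟪z,n⟫^(-2Δ) K n` — `C(ω) ≤ C(n)/cos^{2Δ}∠(ω,n)` for the angular profile. -/
theorem footpoint_bound {n : (EuclideanSpace ℝ (Fin 3))} {K : (EuclideanSpace ℝ (Fin 3)) → ℝ} {Δ : ℝ} (hn : ‖n‖ = 1)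
    (heven : ∀ x, K (-x) = K x) (hinv : ∀ x, K ((ℝ ∙ n)ᗮ.reflection x) = K x)
    (hRP : ∀ (m : ℕ) (p : Fin m → (EuclideanSpace ℝ (Fin 3))) (c : Fin m → ℝ), (∀ a, 0 < inner ℝ (p a) n) →
      0 ≤ ∑ a, ∑ b, c a * c b * K (p a - ((ℝ ∙ n)ᗮ).reflection (p b)))
    (hhom : ∀ c : ℝ, 0 < c → ∀ x, K (c • x) = c ^ (-(2 * Δ)) * K x)
    (hKn : 0 ≤ K n) {z : (EuclideanSpace ℝ (Fin 3))} (hz : 0 < ⟪z, n⟫_ℝ) :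
    K z ≤ ⟪z, n⟫_ℝ ^ (-(2 * Δ)) * K n := by
  have hsymm := mirrorKernel_symm_of_even heven hinv
  set t := ⟪z, n⟫_ℝ with ht
  have hθz : ∀ x : (EuclideanSpace ℝ (Fin 3)), (ℝ ∙ n)ᗮ.reflection x = x - (2 * ⟪x, n⟫_ℝ) • n := by
    intro x; rw [mirrorReflection_apply, hn]; norm_num
  set p : (EuclideanSpace ℝ (Fin 3)) := (1 / 2 : ℝ) • z with hp_def
  set q : (EuclideanSpace ℝ (Fin 3)) := t • n - (1 / 2 : ℝ) • z with hq_def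
  have hnn : ⟪n, n⟫_ℝ = 1 := by rw [real_inner_self_eq_norm_sq, hn]; norm_num
  have hpn : ⟪p, n⟫_ℝ = t / 2 := by
    rw [hp_def, real_inner_smul_left]; ring
  have hqn : ⟪q, n⟫_ℝ = t / 2 := by
    rw [hq_def, inner_sub_left, real_inner_smul_left, real_inner_smul_left, hnn, ← ht]; ring
  have hp : 0 < ⟪p, n⟫_ℝ := by rw [hpn]; linarith
  have hq : 0 < ⟪q, n⟫_ℝ := by rw [hqn]; linarith
  have hpq : p - (ℝ ∙ n)ᗮ.reflection q = z := by
    rw [hθz q, hqn, hq_def, hp_def]; module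
  have hpp : p - (ℝ ∙ n)ᗮ.reflection p = t • n := by
    rw [hθz p, hpn, hp_def]; module
  have hqq : q - (ℝ ∙ n)ᗮ.reflection q = t • n := by
    rw [hθz q, hqn]; module
  have key := rp_two_point hRP hsymm hp hq
  rw [hpq, hpp, hqq] at key
  have htn : K (t • n) = t ^ (-(2 * Δ)) * K n := hhom t hz n
  rw [htn] at key
  have hrhs : 0 ≤ t ^ (-(2 * Δ)) * K n := mul_nonneg (Real.rpow_nonneg hz.le _) hKn
  nlinarith [key, hrhs, sq_nonneg (K z - t ^ (-(2 * Δ)) * K n)]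

end Summit.CriticalPhenomena.Ising3DConformalLimit.Theorems.HRP2Rigidity.Negative
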